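import Summits.ResolutionOfSingularities.ResolutionOfSingularities.Theorems.FrobeniusClosingSteerArithTransportSatelliteWord
import Summits.ResolutionOfSingularities.ResolutionOfSingularities.Theorems.FrobeniusClosingSteerPointStepOrderBound
import Summits.ResolutionOfSingularities.ResolutionOfSingularities.Theorems.FrobeniusClosingSteerVisitLawExcClord
import Summits.ResolutionOfSingularities.ResolutionOfSingularities.Theorems.FrobeniusClosingSteerVisitLawDelta
import Summits.ResolutionOfSingularities.ResolutionOfSingularities.Theorems.FrobeniusClosingSteerSatelliteStep
import Literature.AlgebraicGeometry.Resolution.RegularLocalRingsNormal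
import Literature.AlgebraicGeometry.Resolution.RegularLocalRingsQuotient
import Mathlib.RingTheory.IntegralClosure.IntegrallyClosed
import Mathlib.Algebra.CharP.Two
import Mathlib.Algebra.CharP.Subring
import HarnessLib

/-!
# Crux `Steer` (stmt-ResolutionOfSingularities-16345), chain W4.1, β-leaf K-β0(b) — the seventh visit word (S-BB) HOLDS:
# `oddSatelliteSurvivesTwoN_holds : ArithTransport.OddSatelliteSurvivesTwoN` (tri-1 D·S4 for the odd divisor of a B-stage)

OURS (campaign `res-hironaka`, rung L ★L-G4, slot W4.1; seat res-L0-w41-stub-3 g8). Candidates, not facts; nothing here is a statement of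
H. Hironaka's manuscript [Hironaka2017] (status: under review). AI-written; AI review is weaker than expert review. Theses-free, definition-free.

THE PROOF. At the visit pair `(j, j′)` (B-stage `j` along `x`, exceptional parameter `u`, `v x < v u`), in `R₁ := R (j+1) = R j′`:
* `x′ := x/u ∈ 𝔪_{R₁} ∖ 𝔪_{R₁}²` — the weak transform of the regular parameter `x` (`PointStepOrderBound.div_pow_not_mem_pow_succ_of_pointStep`,
  `ν = 1`; `x′ ∈ 𝔪` by value);
* `u ∉ (x′)`: `u = x′c` with `c ∈ 𝔪` contradicts `u ∉ 𝔪²` (`VisitLawPointStep.prime_excParam_succ`), and with `c` a unit it gives `x′ ∈ (u)`,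
  contradicting `VisitLaw.sq_mod_exc_of_weakTransform` (the weak transform of an element of order exactly `1` is not `≡ 0²` modulo `u`);
* the squared visit law (`VisitLawDelta.visitLaw₂_of_run`, characteristic `2`): `u^(2e)·(f′W²) = (η + G₁)² + u·x′·G` where `f_j = η² + x·G`
  (`x` odd at `j`) and `d + 1 = 2e`;
* in `D := R₁/(x′)` — regular (`IsRegularLocalRing.quotient_span_singleton`), a domain, integrally closed — `ū^(2e)·F̄ = b̄²` with `ū ≠ 0`
  makes `b̄/ū^e` integral, hence `F̄ = ā²` (`sq_of_pow_mul_eq_sq`), so `f′ ≡ (aW⁻¹)² (mod x′)`: clord along `x′` is `≥ 1`;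
* clord `≤ 1` by (δ) `VisitLawDelta.clord_le_one_of_noSingularHeightOne` (N4's height-one clause at `j′`).
[cite: Matsumura1987, Thm. 14.2, Thm. 17.10, Thm. 19.4] [folklore]
-/

-- `Summit.<S>.<S>.…` duplicates the summit name by design (single-problem summit).
set_option linter.dupNamespace false

open IsLocalRing
open Literature.AlgebraicGeometry.Resolution
open Summit.ResolutionOfSingularities.ResolutionOfSingularities.Theorems.SwitchingDichotomy.Words

namespace Summit.ResolutionOfSingularities.ResolutionOfSingularities.Theorems.SwitchingDichotomy.ArithTransport

/-! ## §1 Squares in an integrally closed domain and modulo a regular parameter -/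

section Algebra

/-- In an integrally closed domain, `u^(2e)·F = b²` with `u ≠ 0` forces `F` to be a square (`b/u^e` is integral). [folklore] -/
theorem sq_of_pow_mul_eq_sq {D : Type} [CommRing D] [IsDomain D] [IsIntegrallyClosed D] {u F b : D} (hu : u ≠ 0) (e : ℕ)
    (h : u ^ (2 * e) * F = b ^ 2) : ∃ a : D, F = a ^ 2 := by
  set L := FractionRing D
  have hinj : Function.Injective (algebraMap D L) := IsFractionRing.injective D L
  have hue : algebraMap D L u ^ e ≠ 0 := pow_ne_zero _ (fun h0 => hu (hinj (by rw [h0, map_zero])))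
  set y : L := algebraMap D L b / algebraMap D L u ^ e with hy
  have hy2 : y ^ 2 = algebraMap D L F := by
    rw [hy, div_pow, div_eq_iff (pow_ne_zero _ hue), ← pow_mul, ← map_pow, ← map_pow, ← map_mul, ← h, mul_comm e 2, mul_comm]
  have hint : IsIntegral D y := by
    refine ⟨Polynomial.X ^ 2 - Polynomial.C F, Polynomial.monic_X_pow_sub_C F two_ne_zero, ?_⟩
    simp only [Polynomial.eval₂_sub, Polynomial.eval₂_X_pow, Polynomial.eval₂_C, hy2, sub_self]
  obtain ⟨a, ha⟩ := IsIntegrallyClosed.algebraMap_eq_of_integral hint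
  refine ⟨a, hinj ?_⟩
  rw [map_pow, ha, hy2]

/-- **A square modulo a regular parameter**: in a regular local ring `S`, `x′ ∈ 𝔪 ∖ 𝔪²`, `u ∉ (x′)`, `W` a unit and
`u^(2e)·(f·W²) = b² + u·x′·G` ⇒ `f ≡ g² (mod x′)` for some `g`. [cite: Matsumura1987, Thm. 14.2, Thm. 19.4] [folklore] -/
theorem exists_sub_sq_mem_span_of_law {S : Type} [CommRing S] [IsRegularLocalRing S] {x' u f W Winv b G : S} (e : ℕ)
    (hx'm : x' ∈ maximalIdeal S) (hx'2 : x' ∉ maximalIdeal S ^ 2) (hux : u ∉ Ideal.span {x'}) (hW : W * Winv = 1)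
    (hlaw : u ^ (2 * e) * (f * W ^ 2) = b ^ 2 + u * x' * G) : ∃ g : S, f - g ^ 2 ∈ Ideal.span {x'} := by
  haveI hD : IsRegularLocalRing (S ⧸ Ideal.span {x'}) := (IsRegularLocalRing.quotient_span_singleton hx'm hx'2).1
  haveI := isDomain_of_isRegularLocalRing (S ⧸ Ideal.span {x'})
  haveI := isIntegrallyClosed_of_isRegularLocalRing (S ⧸ Ideal.span {x'})
  set π := Ideal.Quotient.mk (Ideal.span ({x'} : Set S)) with hπ
  have hπu : π u ≠ 0 := fun h0 => hux (Ideal.Quotient.eq_zero_iff_mem.mp h0)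
  have hπx : π x' = 0 := Ideal.Quotient.eq_zero_iff_mem.mpr (Ideal.mem_span_singleton_self x')
  have hlawD : π u ^ (2 * e) * π (f * W ^ 2) = π b ^ 2 := by
    have := congrArg π hlaw
    simp only [map_mul, map_pow, map_add, hπx, mul_zero, zero_mul, add_zero] at this
    simpa only [map_mul, map_pow] using this
  obtain ⟨ā, hā⟩ := sq_of_pow_mul_eq_sq hπu e hlawD
  obtain ⟨a, rfl⟩ := Ideal.Quotient.mk_surjective ā
  refine ⟨a * Winv, ?_⟩
  have e1 : f - (a * Winv) ^ 2 = Winv ^ 2 * (f * W ^ 2 - a ^ 2) + f * (1 - (W * Winv) ^ 2) + 0 := by ring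
  rw [e1, hW, one_pow, sub_self, mul_zero, add_zero, add_zero]
  refine Ideal.mul_mem_left _ _ ?_
  rw [← Ideal.Quotient.eq_zero_iff_mem, map_sub, map_pow]
  exact sub_eq_zero.mpr hā

end Algebra

/-! ## §2 The word (S-BB) holds -/

section Run

variable {K : Type} [Field K]

/-- **(S-BB) `OddSatelliteSurvivesTwoN` HOLDS**: at a visit pair leaving a B-stage `j` along the odd divisor `x` with an exceptional parameter `u`
of larger value, `x / u` is an odd divisor at `j′` (module docstring for the proof). OURS. (folklore) -/
theorem oddSatelliteSurvivesTwoN_holds : OddSatelliteSurvivesTwoN := by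
  intro K _ _ O R P t s hrun hdom0 hreg hdim j j' x u d hd h3 hv hu hΓ h1 hBj hclj hlt
  classical
  haveI hRloc : ∀ i, IsLocalRing (R i) := fun i => (hrun.2 i).1
  have hbl : ∀ i, IsLocalBlowupAlong O (R i) (P i) (R (i + 1)) := fun i => (hrun.2 i).2.2.2.1
  have hdom : ∀ i, SubringDominates (R i) O.toSubring := fun i => VisitLawPointStep.subringDominates_of_run hrun hdom0 i
  have hval : ∀ i (a : R i), a ∈ maximalIdeal (R i) ↔ O.valuation (a : K) < 1 := fun i =>
    (subringDominates_valuationSubring_iff (hdom i).1).mp (hdom i)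
  have h2 : (2 : K) = 0 := CharTwo.two_eq_zero
  -- ### the point step `j`: `P j = 𝔪`, the exceptional parameter `u`
  obtain ⟨_, hPj⟩ := hv.2.1
  have hxtrip : (∃ h : u ∈ R j, (⟨u, h⟩ : R j) ∈ P j) ∧ u ≠ 0 ∧
      ∀ y : R j, y ∈ P j → O.valuation (y : K) ≤ O.valuation u := hu
  obtain ⟨⟨huR, huP⟩, hu0, humax⟩ := hu
  have hum : (⟨u, huR⟩ : R j) ∈ maximalIdeal (R j) := by rw [← hPj]; exact huP
  have humax' : ∀ y : R j, y ∈ maximalIdeal (R j) → O.valuation (y : K) ≤ O.valuation u :=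
    fun y hy => humax y (by rw [hPj]; exact hy)
  have hbl𝔪 : IsLocalBlowupAlong O (R j) (maximalIdeal (R j)) (R (j + 1)) := by rw [← hPj]; exact hbl j
  haveI hregj : IsRegularLocalRing (R j) := hreg j
  haveI hreg1 : IsRegularLocalRing (R (j + 1)) := hreg (j + 1)
  have hle : R j ≤ R (j + 1) := (hbl j).isLocalBlowup.le
  have hu1 : u ∈ R (j + 1) := hle huR
  obtain ⟨-, hu2, -⟩ := VisitLawPointStep.prime_excParam_succ hrun hdom0 hv.2.1 (hreg j) (hreg (j + 1)) hxtrip hu1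
  have hu00 : (⟨u, huR⟩ : R j) ≠ 0 := fun h0 => hu0 (congrArg Subtype.val h0)
  -- ### the odd divisor `x` at `j`: `f_j − η² = c₀ · x^(k'+1)`
  obtain ⟨_, hxR, hxm, hx2, k, hk, hxR', hsj, ⟨η, hη⟩, -⟩ := hBj.2
  have hx0 : x ≠ 0 := by
    rintro rfl
    exact hx2 (by rw [show (⟨(0 : K), hxR⟩ : R j) = 0 from Subtype.ext rfl]; exact Ideal.zero_mem _)
  obtain ⟨c₀, hc₀⟩ := Ideal.mem_span_singleton'.mp hη
  obtain ⟨k', rfl⟩ : ∃ k', k = k' + 1 := ⟨k - 1, by obtain ⟨m, rfl⟩ := hk; omega⟩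
  have hc₀K : (c₀ : K) * x ^ (k' + 1) = s j ^ 2 - (η : K) ^ 2 := by
    have := congrArg Subtype.val hc₀
    push_cast at this
    exact this
  -- ### the weak transform `w = x / u ∈ 𝔪_{R (j+1)} ∖ 𝔪²`
  obtain ⟨w, hw, hw2⟩ := PointStepOrderBound.div_pow_not_mem_pow_succ_of_pointStep (hdom j) hbl𝔪 huR hum hu0 humax'
    (h := ⟨x, hxR⟩) (ν := 1) (by rw [pow_one]; exact hxm) hx2
  have hwK : (w : K) * u = x := by simpa using hw
  have hxu : x / u = (w : K) := by rw [div_eq_iff hu0, hwK]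
  have hvu0 : O.valuation u ≠ 0 := (map_ne_zero _).mpr hu0
  have hwm : w ∈ maximalIdeal (R (j + 1)) := by
    rw [hval (j + 1) w, ← hxu, map_div₀, div_lt_one₀ (pos_iff_ne_zero.mpr hvu0)]
    exact hlt
  -- ### `u ∉ (w)`: else `w ≡ 0² (mod u)`, impossible for the weak transform of an element of order exactly `1`
  have hS1 : R (j + 1) = locAtCentre (blowupRing (R j) u) O :=
    DivisorTrigger.eq_locAtCentre_blowupRing hbl𝔪 huR hum hu0 humax'
  have huw : (⟨u, hu1⟩ : R (j + 1)) ∉ Ideal.span {w} := by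
    intro hmem
    obtain ⟨c, hc⟩ := Ideal.mem_span_singleton'.mp hmem
    by_cases hcm : c ∈ maximalIdeal (R (j + 1))
    · apply hu2
      rw [← hc, pow_two]
      exact Ideal.mul_mem_mul hcm hwm
    · have hcu : IsUnit c := by rwa [mem_maximalIdeal, mem_nonunits_iff, not_not] at hcm
      obtain ⟨ci, hci⟩ := hcu.exists_left_inv
      have hwu : w - 0 ^ 2 ∈ Ideal.span {(⟨u, hu1⟩ : R (j + 1))} := by
        rw [zero_pow two_ne_zero, sub_zero]
        refine Ideal.mem_span_singleton'.mpr ⟨ci, ?_⟩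
        rw [← hc, ← mul_assoc, hci, one_mul]
      exact (VisitLaw.sq_mod_exc_of_weakTransform (hdom j) hum hu00 humax' hS1 (h := ⟨x, hxR⟩) (ν := 1)
        (by rw [pow_one]; exact hxm) hx2 hu1 w 0 hw hwu).1 rfl
  -- ### the visit law, squared (characteristic `2`)
  obtain ⟨m, rfl⟩ := hd
  obtain ⟨⟨hRj', G₁, W, hG₁, hW, hWinv, hW0, hlaw⟩, -, -⟩ :=
    VisitLawDelta.visitLaw₂_of_run hrun hdom0 hv hxtrip hΓ hreg h1 (by omega : 2 ≤ 2 * m + 1 + 1) hclj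
  have he : (2 * m + 1 + 1) / 2 = m + 1 := by omega
  rw [he] at hlaw
  have hlawsq : (s j' * u ^ (m + 1) * W) ^ 2 = (s j - G₁) ^ 2 := by rw [hlaw]
  have hs' : s j' ^ 2 ∈ R j' := (hrun.2 j').2.1
  have hK : u ^ (2 * (m + 1)) * (s j' ^ 2 * W ^ 2) = ((η : K) + G₁) ^ 2 + u * (w : K) * ((x : K) ^ k' * (c₀ : K)) := by
    linear_combination hlawsq - hc₀K - ((c₀ : K) * x ^ k') * hwK - ((η : K) * G₁ + s j * G₁) * h2
  -- the same identity in the member `R (j + 1)`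
  have hlaw1 : (⟨u, hu1⟩ : R (j + 1)) ^ (2 * (m + 1)) *
      ((⟨s j' ^ 2, hRj' ▸ hs'⟩ : R (j + 1)) * (⟨W, hRj' ▸ hW⟩ : R (j + 1)) ^ 2) =
      ((⟨(η : K), hle η.2⟩ : R (j + 1)) + ⟨G₁, hRj' ▸ hG₁⟩) ^ 2 +
        ⟨u, hu1⟩ * w * ((⟨x, hle hxR⟩ : R (j + 1)) ^ k' * ⟨(c₀ : K), hle c₀.2⟩) := by
    apply Subtype.ext
    push_cast
    exact hK
  have hWW : (⟨W, hRj' ▸ hW⟩ : R (j + 1)) * ⟨W⁻¹, hRj' ▸ hWinv⟩ = 1 := Subtype.ext (mul_inv_cancel₀ hW0)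
  obtain ⟨g₁, hg₁⟩ := exists_sub_sq_mem_span_of_law (m + 1) hwm hw2 huw hWW hlaw1
  -- ### transport to the index `j′` (`R j′ = R (j+1)` as subrings) and conclude with (δ)
  have key : ∀ (S : Subring K) (hS : S = R (j + 1)) [IsLocalRing S] (hwS : (w : K) ∈ S) (hsS : s j' ^ 2 ∈ S),
      (⟨(w : K), hwS⟩ : S) ∈ maximalIdeal S ∧ (⟨(w : K), hwS⟩ : S) ∉ maximalIdeal S ^ 2 ∧
      ∃ g : S, (⟨s j' ^ 2, hsS⟩ : S) - g ^ 2 ∈ Ideal.span {(⟨(w : K), hwS⟩ : S) ^ 1} := by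
    intro S hS _ hwS hsS
    subst hS
    have hw' : (⟨(w : K), hwS⟩ : R (j + 1)) = w := Subtype.ext rfl
    rw [hw', pow_one]
    exact ⟨hwm, hw2, g₁, hg₁⟩
  have hwj' : (w : K) ∈ R j' := by rw [hRj']; exact w.2
  obtain ⟨hm', hm2', g', hg'⟩ := key (R j') hRj' hwj' hs'
  have hw0 : (⟨(w : K), hwj'⟩ : R j') ≠ 0 := fun h0 => by
    have hw00 : (w : K) = 0 := congrArg Subtype.val h0
    apply hx0
    rw [← hwK, hw00, zero_mul]
  rw [hxu]
  haveI := hreg j'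
  refine ⟨hRloc j', hwj', hm', hm2', 1, odd_one, hwj', hs', ⟨g', hg'⟩, fun g hg => ?_⟩
  have h2le := VisitLawDelta.clord_le_one_of_noSingularHeightOne (R j') ⟨s j' ^ 2, hs'⟩ hm' hm2' hw0 (h1 hs') ⟨g, hg⟩
  omega

end Run

end Summit.ResolutionOfSingularities.ResolutionOfSingularities.Theorems.SwitchingDichotomy.ArithTransport
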